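import Literature.NumberTheory.LFunctions.ZeroSumWindowBounds
import HarnessLib

/-!
# Power sums over the non-trivial zeros of `ζ`: `Σ_ρ m(ρ)/|ρ|^σ < ∞` for every `σ > 1`

NOT RH-BEARING. RH-FREE literature (a convergence statement about the multiset of non-trivial
zeros; it counts zeros by height, it says nothing about their real parts). Topic
`Literature/NumberTheory/LFunctions`. Everything in this file is PROVED (no definitions, no named
facts).

The classical consequence of the unit-window count `N(T+1) − N(T) ≪ log(T+2)`
(Montgomery–Vaughan Thm. 10.13; Titchmarsh Thm. 9.2): for every real `σ > 1` the series
`Σ_ρ |ρ|^{-σ}`, over the non-trivial zeros `ρ = β + iγ` of `ζ` counted with multiplicity, converges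
(Montgomery–Vaughan, remark after Thm. 10.13: "Hence `Σ_ρ |ρ|^{-A} < ∞` for all `A > 1`";
Titchmarsh (9.4.4) `|ρ_n| ∼ γ_n ∼ 2πn/log n`), and in fact `Σ_ρ m(ρ)/(1 + |γ|)^σ < ∞`, hence
`Σ_ρ m(ρ)/|ρ − z₀|^σ < ∞` for every fixed `z₀ ∈ ℂ`.
The tree already holds the case `σ = 2` in several forms
(`Literature.NumberTheory.LFunctions.summable_zeroOrder_div_norm_sq`,
`Literature.NumberTheory.LFunctions.ZetaZeroSum.summable_zeroOrder_div_one_add_sq`,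
`Literature.NumberTheory.LFunctions.summable_weight_zetaZeros`); the general exponent `σ > 1` is
what the Weil-type computations with separation exponent `1 + δ` quote (Suzuki, *Canad. J. Math.*
2025 = arXiv:2301.00421, proof of Thm. 1.3, "`Σ_γ m_γ |γ|^{-1-δ} < ∞`", in the variable
`γ = i(ρ − 1/2)`, i.e. `|γ| = |ρ − 1/2|` — `summable_zeroOrder_div_norm_sub_half_rpow` below).

## The argument

We do not redo the window count: the tree's
`Literature.NumberTheory.LFunctions.ZetaZeroSum.exists_tsum_zeroOrder_div_sq_le`
(Montgomery–Vaughan Lemma 12.1 via Thm. 10.13, the zeros with `Re ρ < 1/4` already reflected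
there) gives `Σ_ρ m(ρ)/(1 + (γ − t)²) ≤ C log(|t| + 4)` for every real `t`, over ALL non-trivial
zeros. Partition the zeros by the nearest integer `k = round γ` (Mathlib's `summable_partition`
for non-negative families): inside the window `|γ − k| ≤ 1/2` one has
`m(ρ)/(1 + |γ|)^σ ≤ (5/4)(1/2 + |k|)^{-σ} · m(ρ)/(1 + (γ − k)²)`, so each window sum is at most
`(5/4) C log(|k| + 4)/(1/2 + |k|)^σ`, which is summable over `k ∈ ℤ` for `σ > 1`
(`log x ≤ x^ε/ε` and the `p`-series `Real.summable_one_div_int_add_rpow`). The shifted sums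
`Σ m(ρ)/|ρ − z₀|^σ` follow because `|ρ − z₀| ≥ (1 + |γ|)/2` for all but the finitely many zeros
with `|γ| < 2(|Im z₀| + 1)` (`IsCompact.inter_riemannZetaZeros_finite`).

## Main results (all over the subtype `ZetaZeros.riemannZetaNontrivialZeros`, multiplicity
`riemannZetaZeroOrder`)

* `ZetaZeroSum.summable_zeroOrder_div_one_add_abs_im_rpow` : `Σ_ρ m(ρ)/(1+|γ|)^σ < ∞`, `σ > 1`.
* `ZetaZeroSum.summable_zeroOrder_div_norm_sub_rpow` : `Σ_ρ m(ρ)/|ρ − z₀|^σ < ∞`, `σ > 1`, any `z₀`.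
* `ZetaZeroSum.summable_zeroOrder_div_norm_rpow` : `Σ_ρ m(ρ)/|ρ|^σ < ∞` (MV, remark after Thm. 10.13).
* `ZetaZeroSum.summable_zeroOrder_div_norm_sub_half_rpow` : `Σ_ρ m(ρ)/|ρ − 1/2|^σ < ∞`
  (Suzuki's `Σ_γ m_γ|γ|^{-σ}`).
* `ZetaZeroSum.summable_zeroOrder_div_norm_I_mul_sub_half_rpow` : the same with `|i(ρ − 1/2)|`.
* `ZetaZeroSum.summable_zeroOrder_div_abs_im_rpow` : `Σ_ρ m(ρ)/|γ|^σ < ∞`.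

(Private helpers: `summable_log_div_rpow_int`, `Σ_{k ∈ ℤ} log(|k|+4)/(1/2+|k|)^p < ∞` for
`p > 1`; `finite_abs_im_lt`, finitely many non-trivial zeros with `|γ| < R` — the public form is
`Literature.NumberTheory.LFunctions.riemannZetaNontrivialZeros_finite_inter_ball`.)

What is NOT here: the divergence for `σ ≤ 1` (it needs the Riemann–von Mangoldt lower bound
`N(T) ≫ T log T`; the tree has `riemann_von_mangoldt_holds`, not needed by any current user), and
any statement about `Re ρ`.

## References

* H. L. Montgomery, R. C. Vaughan, *Multiplicative Number Theory I*, CUP 2007, Thm. 10.13 and the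
  remark following it ("Hence `Σ_ρ |ρ|^{-A} < ∞` for all `A > 1`"), Lemma 12.1.
  [cite: MontgomeryVaughan2007, Theorem 10.13]
* E. C. Titchmarsh, *The Theory of the Riemann Zeta-Function*, 2nd ed., OUP 1986, Thm. 9.2
  (`N(T+1) − N(T) = O(log T)`) and (9.4.4). [cite: Titchmarsh1986, Theorem 9.2]
* M. Suzuki, *Hilbert spaces and the Riemann Hypothesis* (working title of arXiv:2301.00421v3),
  Canad. J. Math. (2025), proof of Thm. 1.3 (user of the `1 + δ` exponent; not a source of proof).
-/

noncomputable section

open Complex Filter Set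
open scoped Topology

namespace Literature.NumberTheory.LFunctions

namespace ZetaZeroSum

/-! ### A summable weight over `ℤ` -/

/-- For `p > 1`, `Σ_{k ∈ ℤ} log(|k| + 4)/(1/2 + |k|)^p < ∞` (compare `log x ≤ x^ε/ε` with
`ε = (p−1)/2` and the `p`-series `Σ 1/|k + 1/2|^{p−ε}`). [folklore] -/
private theorem summable_log_div_rpow_int {p : ℝ} (hp : 1 < p) :
    Summable fun k : ℤ ↦ Real.log (|(k : ℝ)| + 4) / (1 / 2 + |(k : ℝ)|) ^ p := by
  set ε : ℝ := (p - 1) / 2 with hε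
  have hε0 : 0 < ε := by rw [hε]; linarith
  have hq : 1 < p - ε := by rw [hε]; linarith
  have hq0 : 0 ≤ p - ε := by linarith
  have hsum : Summable fun k : ℤ ↦ 1 / |(k : ℝ) + 1 / 2| ^ (p - ε) :=
    (Real.summable_one_div_int_add_rpow (1 / 2) (p - ε)).2 hq
  refine Summable.of_nonneg_of_le (fun k ↦ ?_) (fun k ↦ ?_) (hsum.mul_left (8 ^ ε / ε))
  · have : 0 ≤ Real.log (|(k : ℝ)| + 4) := Real.log_nonneg (by linarith [abs_nonneg (k : ℝ)])
    positivity
  · have hk0 : 0 ≤ |(k : ℝ)| := abs_nonneg _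
    set a : ℝ := 1 / 2 + |(k : ℝ)| with ha
    have ha0 : 0 < a := by positivity
    have h1 : Real.log (|(k : ℝ)| + 4) ≤ (|(k : ℝ)| + 4) ^ ε / ε :=
      Real.log_le_rpow_div (by positivity) hε0
    have h2 : (|(k : ℝ)| + 4) ^ ε ≤ (8 * a) ^ ε :=
      Real.rpow_le_rpow (by positivity) (by rw [ha]; linarith) hε0.le
    have h3 : (8 * a) ^ ε = 8 ^ ε * a ^ ε := Real.mul_rpow (by norm_num) ha0.le
    have h4 : |(k : ℝ) + 1 / 2| ≤ a := by
      rw [ha]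
      calc |(k : ℝ) + 1 / 2| ≤ |(k : ℝ)| + |(1 / 2 : ℝ)| := abs_add_le _ _
        _ = 1 / 2 + |(k : ℝ)| := by rw [abs_of_pos (by norm_num : (0 : ℝ) < 1 / 2)]; ring
    have h5 : 0 < |(k : ℝ) + 1 / 2| := by
      rw [abs_pos]
      intro h
      have h2k : (2 * k : ℤ) = -1 := by exact_mod_cast (by linarith : (2 * k : ℝ) = -1)
      omega
    have hap : 0 < a ^ p := Real.rpow_pos_of_pos ha0 p
    calc Real.log (|(k : ℝ)| + 4) / a ^ p ≤ (8 ^ ε * a ^ ε / ε) / a ^ p := by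
          refine div_le_div_of_nonneg_right (h1.trans ?_) hap.le
          rw [← h3]
          exact div_le_div_of_nonneg_right h2 hε0.le
      _ = 8 ^ ε / ε * (1 / a ^ (p - ε)) := by
          rw [Real.rpow_sub ha0, one_div_div]; ring
      _ ≤ 8 ^ ε / ε * (1 / |(k : ℝ) + 1 / 2| ^ (p - ε)) := by
          refine mul_le_mul_of_nonneg_left ?_ (by positivity)
          exact one_div_le_one_div_of_le (Real.rpow_pos_of_pos h5 _)
            (Real.rpow_le_rpow (abs_nonneg _) h4 hq0)

/-! ### The height form `Σ_ρ m(ρ)/(1 + |γ|)^σ` -/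

/-- **`Σ_ρ m(ρ)/(1 + |Im ρ|)^σ < ∞` for `σ > 1`**, over the non-trivial zeros of `ζ` with
multiplicity: the unit-window count `N(T+1) − N(T) ≪ log(T+2)` summed against `(1/2+|k|)^{-σ}`
(here through the tree's window bound `ZetaZeroSum.exists_tsum_zeroOrder_div_sq_le`, Montgomery–Vaughan
Lemma 12.1, and the partition of the zeros by `k = round γ`); equivalent to the printed
"`Σ_ρ |ρ|^{-A} < ∞` for all `A > 1`" since `|γ| ≤ |ρ| ≤ 1 + |γ|`.
[cite: MontgomeryVaughan2007, Theorem 10.13 and the remark following it] -/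
theorem summable_zeroOrder_div_one_add_abs_im_rpow {σ : ℝ} (hσ : 1 < σ) :
    Summable fun ρ : RHWave0.riemannZetaNontrivialZeros ↦
      (riemannZetaZeroOrder (ρ : ℂ) : ℝ) / (1 + |(ρ : ℂ).im|) ^ σ := by
  classical
  obtain ⟨C, hC0, hC⟩ := exists_tsum_zeroOrder_div_sq_le
  set f : RHWave0.riemannZetaNontrivialZeros → ℝ := fun ρ ↦
    (riemannZetaZeroOrder (ρ : ℂ) : ℝ) / (1 + |(ρ : ℂ).im|) ^ σ with hf
  have hf0 : 0 ≤ f := fun ρ ↦ div_nonneg (zeroOrder_nonneg ρ) (by positivity)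
  -- the window weights `g k ρ = m(ρ)/(1 + (γ − k)²)` and their bound
  set g : ℤ → RHWave0.riemannZetaNontrivialZeros → ℝ := fun k ρ ↦
    (riemannZetaZeroOrder (ρ : ℂ) : ℝ) / (1 + ((ρ : ℂ).im - k) ^ 2) with hg
  have hg0 : ∀ k ρ, 0 ≤ g k ρ := fun k ρ ↦ div_nonneg (zeroOrder_nonneg ρ) (by positivity)
  have hwin : ∀ k : ℤ, Summable (g k) ∧ ∑' ρ, g k ρ ≤ C * Real.log (|(k : ℝ)| + 4) := by
    intro k
    have h := hC k 1 one_pos le_rfl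
    simp only [one_pow, div_one] at h
    exact h
  -- the partition of the zeros by the nearest integer to the ordinate
  set s : ℤ → Set RHWave0.riemannZetaNontrivialZeros := fun k ↦ {ρ | round ((ρ : ℂ).im) = k}
    with hs
  have hpart : ∀ ρ : RHWave0.riemannZetaNontrivialZeros, ∃! k, ρ ∈ s k :=
    fun ρ ↦ ⟨round ((ρ : ℂ).im), rfl, fun k hk ↦ hk.symm⟩
  -- the window factor `w k = (5/4)/(1/2 + |k|)^σ`
  set w : ℤ → ℝ := fun k ↦ (5 / 4) / (1 / 2 + |(k : ℝ)|) ^ σ with hw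
  have hw0 : ∀ k, 0 ≤ w k := fun k ↦ by positivity
  -- pointwise bound inside the window `k`
  have hpt : ∀ (k : ℤ) (ρ : RHWave0.riemannZetaNontrivialZeros), ρ ∈ s k →
      f ρ ≤ w k * g k ρ := by
    intro k ρ hρ
    have hk : round ((ρ : ℂ).im) = k := hρ
    have hγk : |(ρ : ℂ).im - k| ≤ 1 / 2 := by rw [← hk]; exact abs_sub_round _
    have hm := zeroOrder_nonneg ρ
    have hkγ : 1 / 2 + |(k : ℝ)| ≤ 1 + |(ρ : ℂ).im| := by
      have := abs_sub_abs_le_abs_sub (k : ℝ) (ρ : ℂ).im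
      rw [abs_sub_comm] at this
      linarith
    have hden : (1 / 2 + |(k : ℝ)|) ^ σ ≤ (1 + |(ρ : ℂ).im|) ^ σ :=
      Real.rpow_le_rpow (by positivity) hkγ (by linarith)
    have hsq : 1 + ((ρ : ℂ).im - k) ^ 2 ≤ 5 / 4 := by
      have : ((ρ : ℂ).im - k) ^ 2 ≤ (1 / 2) ^ 2 := by
        rw [← sq_abs]; exact pow_le_pow_left₀ (abs_nonneg _) hγk 2
      linarith
    have hpos : 0 < (1 / 2 + |(k : ℝ)|) ^ σ := Real.rpow_pos_of_pos (by positivity) σ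
    have hq0 : 0 < 1 + ((ρ : ℂ).im - k) ^ 2 := by positivity
    calc f ρ = (riemannZetaZeroOrder (ρ : ℂ) : ℝ) / (1 + |(ρ : ℂ).im|) ^ σ := rfl
      _ ≤ (riemannZetaZeroOrder (ρ : ℂ) : ℝ) / (1 / 2 + |(k : ℝ)|) ^ σ :=
          div_le_div_of_nonneg_left hm hpos hden
      _ = 1 / (1 / 2 + |(k : ℝ)|) ^ σ * (g k ρ * (1 + ((ρ : ℂ).im - k) ^ 2)) := by
          rw [hg]
          dsimp only
          rw [div_mul_cancel₀ _ hq0.ne']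
          ring
      _ ≤ 1 / (1 / 2 + |(k : ℝ)|) ^ σ * (g k ρ * (5 / 4)) :=
          mul_le_mul_of_nonneg_left (mul_le_mul_of_nonneg_left hsq (hg0 k ρ)) (by positivity)
      _ = w k * g k ρ := by rw [hw]; ring
  -- summability by windows
  refine (summable_partition hf0 hpart).2 ⟨fun k ↦ ?_, ?_⟩
  · exact Summable.of_nonneg_of_le (fun ρ ↦ hf0 _) (fun ρ ↦ hpt k ρ ρ.2)
      (((hwin k).1.mul_left (w k)).subtype _)
  · refine Summable.of_nonneg_of_le (fun k ↦ tsum_nonneg fun ρ ↦ hf0 _) (fun k ↦ ?_)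
      ((summable_log_div_rpow_int hσ).mul_left (5 / 4 * C))
    have hwg : Summable fun ρ ↦ w k * g k ρ := (hwin k).1.mul_left (w k)
    calc ∑' ρ : s k, f ρ ≤ ∑' ρ : s k, w k * g k ρ :=
          Summable.tsum_le_tsum (fun ρ ↦ hpt k ρ ρ.2)
            (Summable.of_nonneg_of_le (fun ρ ↦ hf0 _) (fun ρ ↦ hpt k ρ ρ.2) (hwg.subtype _))
            (hwg.subtype _)
      _ ≤ ∑' ρ, w k * g k ρ :=
          Summable.tsum_subtype_le _ _ (fun ρ ↦ mul_nonneg (hw0 k) (hg0 k ρ)) hwg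
      _ = w k * ∑' ρ, g k ρ := tsum_mul_left
      _ ≤ w k * (C * Real.log (|(k : ℝ)| + 4)) := mul_le_mul_of_nonneg_left (hwin k).2 (hw0 k)
      _ = 5 / 4 * C * (Real.log (|(k : ℝ)| + 4) / (1 / 2 + |(k : ℝ)|) ^ σ) := by
          rw [hw]; ring

/-! ### Finitely many zeros of small height; the shifted power sums -/

/-- Only finitely many non-trivial zeros have `|Im ρ| < R`: they lie in the compact rectangle
`[0, 1] × [−R, R]`, which meets the (discrete, closed) zero set of `ζ` in a finite set
(`IsCompact.inter_riemannZetaZeros_finite`). [folklore] -/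
private theorem finite_abs_im_lt (R : ℝ) :
    {ρ : RHWave0.riemannZetaNontrivialZeros | |(ρ : ℂ).im| < R}.Finite := by
  have hK : IsCompact (Set.Icc (0 : ℝ) 1 ×ℂ Set.Icc (-R) R) :=
    (isCompact_Icc (a := (0 : ℝ)) (b := 1)).reProdIm (isCompact_Icc (a := -R) (b := R))
  have hfin := hK.inter_riemannZetaZeros_finite
  have hsub : {ρ : RHWave0.riemannZetaNontrivialZeros | |(ρ : ℂ).im| < R} ⊆
      Subtype.val ⁻¹' (Set.Icc (0 : ℝ) 1 ×ℂ Set.Icc (-R) R ∩ riemannZetaZeros) := by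
    intro ρ hρ
    have hR : |(ρ : ℂ).im| < R := hρ
    refine ⟨Complex.mem_reProdIm.2 ⟨⟨?_, ?_⟩, ?_⟩, ?_⟩
    · exact (ZetaZeros.riemannZetaNontrivialZeros.re_pos ρ.2).le
    · exact (ZetaZeros.riemannZetaNontrivialZeros.re_lt_one ρ.2).le
    · exact Set.mem_Icc.2 ⟨by linarith [neg_abs_le (ρ : ℂ).im], by linarith [le_abs_self (ρ : ℂ).im]⟩
    · exact ZetaZeros.riemannZetaNontrivialZeros.zeta_eq_zero ρ.2
  exact (hfin.preimage Subtype.val_injective.injOn).subset hsub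

/-- **`Σ_ρ m(ρ)/|ρ − z₀|^σ < ∞` for `σ > 1` and any fixed `z₀ ∈ ℂ`**, over the non-trivial zeros of
`ζ` with multiplicity: `|ρ − z₀| ≥ |γ − Im z₀| ≥ (1 + |γ|)/2` once `|γ| ≥ 2(|Im z₀| + 1)`, and the
remaining zeros are finite in number (`finite_abs_im_lt`). (At a zero with `ρ = z₀`, if any, the
term is `m/0 = 0` by Lean's convention; this does not affect summability.)
[cite: MontgomeryVaughan2007, Theorem 10.13 and the remark following it] -/
theorem summable_zeroOrder_div_norm_sub_rpow (z₀ : ℂ) {σ : ℝ} (hσ : 1 < σ) :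
    Summable fun ρ : RHWave0.riemannZetaNontrivialZeros ↦
      (riemannZetaZeroOrder (ρ : ℂ) : ℝ) / ‖(ρ : ℂ) - z₀‖ ^ σ := by
  have hσ0 : 0 ≤ σ := by linarith
  set R : ℝ := 2 * (|z₀.im| + 1) with hR
  refine Summable.of_norm_bounded_eventually
    ((summable_zeroOrder_div_one_add_abs_im_rpow hσ).mul_left (2 ^ σ)) ?_
  rw [Filter.eventually_cofinite]
  refine (finite_abs_im_lt R).subset fun ρ hρ ↦ ?_
  -- contrapositive: if `|γ| ≥ R` the bound holds
  by_contra hge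
  have hge' : R ≤ |(ρ : ℂ).im| := not_lt.1 hge
  apply hρ
  have hm := zeroOrder_nonneg ρ
  rw [Real.norm_of_nonneg (div_nonneg hm (by positivity))]
  -- `|ρ − z₀| ≥ (1 + |γ|)/2`
  have h1 : (1 + |(ρ : ℂ).im|) / 2 ≤ ‖(ρ : ℂ) - z₀‖ := by
    have him : |((ρ : ℂ) - z₀).im| ≤ ‖(ρ : ℂ) - z₀‖ := Complex.abs_im_le_norm _
    rw [Complex.sub_im] at him
    have htri : |(ρ : ℂ).im| - |z₀.im| ≤ |(ρ : ℂ).im - z₀.im| := abs_sub_abs_le_abs_sub _ _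
    rw [hR] at hge'
    linarith
  have hpos : 0 < (1 + |(ρ : ℂ).im|) / 2 := by positivity
  have h2 : ((1 + |(ρ : ℂ).im|) / 2) ^ σ ≤ ‖(ρ : ℂ) - z₀‖ ^ σ :=
    Real.rpow_le_rpow hpos.le h1 hσ0
  have h3 : ((1 + |(ρ : ℂ).im|) / 2) ^ σ = (1 + |(ρ : ℂ).im|) ^ σ / 2 ^ σ :=
    Real.div_rpow (by positivity) (by norm_num) σ
  have h2σ : 0 < (2 : ℝ) ^ σ := Real.rpow_pos_of_pos (by norm_num) σ
  calc (riemannZetaZeroOrder (ρ : ℂ) : ℝ) / ‖(ρ : ℂ) - z₀‖ ^ σ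
      ≤ (riemannZetaZeroOrder (ρ : ℂ) : ℝ) / ((1 + |(ρ : ℂ).im|) / 2) ^ σ :=
        div_le_div_of_nonneg_left hm (Real.rpow_pos_of_pos hpos σ) h2
    _ = 2 ^ σ * ((riemannZetaZeroOrder (ρ : ℂ) : ℝ) / (1 + |(ρ : ℂ).im|) ^ σ) := by
        rw [h3]; field_simp

/-- **`Σ_ρ |ρ|^{-σ} < ∞` for all `σ > 1`** (non-trivial zeros with multiplicity): Montgomery–Vaughan,
remark after Theorem 10.13, "Hence `Σ_ρ |ρ|^{-A} < ∞` for all `A > 1`" (from `N(T) ≪ T log T`); the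
case `z₀ = 0` of `summable_zeroOrder_div_norm_sub_rpow`. The tree's `σ = 2` instances are
`Literature.NumberTheory.LFunctions.summable_zeroOrder_div_norm_sq` (zeros with `Re ρ ≥ 1/4`) and
`ZetaZeroSum.summable_zeroOrder_div_one_add_sq`.
[cite: MontgomeryVaughan2007, Theorem 10.13 and the remark following it] -/
theorem summable_zeroOrder_div_norm_rpow {σ : ℝ} (hσ : 1 < σ) :
    Summable fun ρ : RHWave0.riemannZetaNontrivialZeros ↦
      (riemannZetaZeroOrder (ρ : ℂ) : ℝ) / ‖(ρ : ℂ)‖ ^ σ := by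
  simpa only [sub_zero] using summable_zeroOrder_div_norm_sub_rpow 0 hσ

/-- **`Σ_ρ m(ρ)/|ρ − 1/2|^σ < ∞` for `σ > 1`**: the power sums centred at `1/2`, i.e.
`Σ_γ m_γ |γ|^{-σ}` in the variable `γ = i(ρ − 1/2)` (`|i(ρ − 1/2)| = |ρ − 1/2|`), as used with
`σ = 1 + δ` in Weil-form separation estimates (Suzuki, arXiv:2301.00421, proof of Thm. 1.3); the
case `z₀ = 1/2` of `summable_zeroOrder_div_norm_sub_rpow`.
[cite: MontgomeryVaughan2007, Theorem 10.13 and the remark following it] -/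
theorem summable_zeroOrder_div_norm_sub_half_rpow {σ : ℝ} (hσ : 1 < σ) :
    Summable fun ρ : RHWave0.riemannZetaNontrivialZeros ↦
      (riemannZetaZeroOrder (ρ : ℂ) : ℝ) / ‖(ρ : ℂ) - 1 / 2‖ ^ σ :=
  summable_zeroOrder_div_norm_sub_rpow (1 / 2) hσ

/-- The same in Suzuki's variable written out: `Σ_ρ m(ρ)/|i(ρ − 1/2)|^σ < ∞` for `σ > 1`.
[cite: MontgomeryVaughan2007, Theorem 10.13 and the remark following it] -/
theorem summable_zeroOrder_div_norm_I_mul_sub_half_rpow {σ : ℝ} (hσ : 1 < σ) :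
    Summable fun ρ : RHWave0.riemannZetaNontrivialZeros ↦
      (riemannZetaZeroOrder (ρ : ℂ) : ℝ) / ‖I * ((ρ : ℂ) - 1 / 2)‖ ^ σ := by
  simpa only [norm_mul, Complex.norm_I, one_mul] using summable_zeroOrder_div_norm_sub_half_rpow hσ

/-- **`Σ_ρ m(ρ)/|Im ρ|^σ < ∞` for `σ > 1`** (sums over the ordinates `γ`, both signs, with
multiplicity): the non-trivial zeros keep a uniform distance `2δ > 0` from the real axis
(`ZetaZeroSum.exists_gap_im`), so `|γ|^{-σ} ≤ ((1+2δ)/(2δ))^σ (1+|γ|)^{-σ}`.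
[cite: MontgomeryVaughan2007, Theorem 10.13 and the remark following it] -/
theorem summable_zeroOrder_div_abs_im_rpow {σ : ℝ} (hσ : 1 < σ) :
    Summable fun ρ : RHWave0.riemannZetaNontrivialZeros ↦
      (riemannZetaZeroOrder (ρ : ℂ) : ℝ) / |(ρ : ℂ).im| ^ σ := by
  have hσ0 : 0 ≤ σ := by linarith
  obtain ⟨δ, hδ0, -, hδ⟩ := exists_gap_im
  set K : ℝ := ((1 + 2 * δ) / (2 * δ)) ^ σ with hK
  refine Summable.of_nonneg_of_le (fun ρ ↦ div_nonneg (zeroOrder_nonneg ρ) (by positivity))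
    (fun ρ ↦ ?_) ((summable_zeroOrder_div_one_add_abs_im_rpow hσ).mul_left K)
  have hm := zeroOrder_nonneg ρ
  have hγ : 2 * δ ≤ |(ρ : ℂ).im| := hδ _ ρ.2
  have hγ0 : 0 < |(ρ : ℂ).im| := by linarith
  -- `1 + |γ| ≤ ((1+2δ)/(2δ)) |γ|`
  have h1 : 1 + |(ρ : ℂ).im| ≤ (1 + 2 * δ) / (2 * δ) * |(ρ : ℂ).im| := by
    rw [div_mul_eq_mul_div, le_div_iff₀ (by positivity)]
    nlinarith
  have h2 : (1 + |(ρ : ℂ).im|) ^ σ ≤ ((1 + 2 * δ) / (2 * δ) * |(ρ : ℂ).im|) ^ σ :=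
    Real.rpow_le_rpow (by positivity) h1 hσ0
  rw [Real.mul_rpow (by positivity) hγ0.le, ← hK] at h2
  have hKpos : 0 < K := by rw [hK]; exact Real.rpow_pos_of_pos (by positivity) σ
  have h3 : 0 < (1 + |(ρ : ℂ).im|) ^ σ := Real.rpow_pos_of_pos (by positivity) σ
  calc (riemannZetaZeroOrder (ρ : ℂ) : ℝ) / |(ρ : ℂ).im| ^ σ
      = K * ((riemannZetaZeroOrder (ρ : ℂ) : ℝ) / (K * |(ρ : ℂ).im| ^ σ)) := by
        field_simp
    _ ≤ K * ((riemannZetaZeroOrder (ρ : ℂ) : ℝ) / (1 + |(ρ : ℂ).im|) ^ σ) :=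
        mul_le_mul_of_nonneg_left (div_le_div_of_nonneg_left hm h3 h2) hKpos.le

end ZetaZeroSum

end Literature.NumberTheory.LFunctions
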